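import Literature.NumberTheory.EllipticCurves.CastellaGrossiSkinner2025.EisensteinPPartBSD
import Literature.NumberTheory.EllipticCurves.GreenbergVatsal2000.IwasawaInvariants
import Literature.NumberTheory.EllipticCurves.IwasawaLeadingTerm
import Literature.NumberTheory.EllipticCurves.AnomalousOfRationalTorsionProofs
import HarnessLib

/-!
# Good Eisenstein primes `p > 2` in analytic rank `≤ 1`: outside class X1, `BSD(E,p)` follows from PUBLISHED theorems (Castella–Grossi–Skinner 2025 Thm D ∪ Greenberg–Vatsal 2000 Thm 1.3 + Greenberg 1999 Thm 4.1)

HONEST FRAMING (cell `b2b-bsdres`, run/shared/lean/b2b/bsd-rank1-residual/): prove what is provable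
now; shrink each hard class to its core with data; no claim beyond stated classes. This file has
THEOREMS ONLY (no new named fact; D-0026): it assembles, in the cell's vocabulary, the statement
behind the sentence "the residual class at a good Eisenstein prime `p > 2` is EXACTLY X1"
(RESIDUAL-CASES §a.1 rows C6 + C7 vs. §a.2 row X1): for `W/ℚ` globally minimal elliptic, `p > 2`
with `good(p) ∧ red(p)` and `ord_{s=1} L(E,s) ≤ 1`, if `(E,p)` is NOT in class X1
(`Rank1Residual.ClassX1 W p := 2 < p ∧ Red ∧ Good ∧ Anom ∧ ¬(r_an = 0 ∧ GVPar)`), then Miller's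
`BSDp W p` holds, from the named PUBLISHED facts

* `CastellaGrossiSkinner2025.thmD_padicValRat_bsd_rank_le_one` (Math. Ann. 393 (2025) Theorem D,
  `¬ anom(p)`, both ranks; harvest seat, p190652) — covered class C6 / census row T-CGS,
* `GreenbergVatsal2000.thm13_charIdeal_eq_of_gvPar` (Invent. Math. 142 (2000) Thm. 1.3 + Kato:
  Mazur's main conjecture under (GV)) with Greenberg's Euler-characteristic formula LNM 1716 Thm. 4.1
  (`greenberg_charValue_rankZero`) and the tree's rank-`0` glue (`pPartRankZero_of_gvPar`, =
  Castella–Grossi–Lee–Skinner 2022 Thm. 5.1.4's printed deduction) — covered chain C7 / row T-GV0,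

plus the standing published inputs of every class theorem of the cell: modularity
(`hasEntireLFunction_rat`, `nonempty_modularParametrizationData`) and Gross–Zagier–Kolyvagin
(`rank_eq_analyticRank_of_analyticRank_le_one`). The only per-pair bit is `p ∤ #E(ℚ)_tors`, consulted
ONLY off the anomalous line (where it is automatic in print: a rational point of order `p` at a good
`p > 2` forces `a_p ≡ 1 (mod p)`; the tree has no such lemma, see the CGS file's docstring item 8).
Case split: `¬ClassX1 ∧ 2 < p ∧ Red ∧ Good` ⟹ `¬Anom ∨ (r_an = 0 ∧ GVPar)`; the first disjunct is
Theorem D, the second is the Greenberg–Vatsal chain (there `anom(p)` gives `p ∤ a_p`, i.e. ordinary,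
`Rank1Residual.goodOrd_of_anom`). No announced input (Keller–Yin) is used anywhere.

References: [CastellaGrossiSkinner2025] Thm. D (arXiv:2303.04373v2; "Thm. 4" in the store's LaTeXML
text); [GreenbergVatsal2000] Thm. (1.3); [GreenbergLNM1716] Thm. 4.1; [CastellaEtAl2021] Thm. 5.1.4;
[Miller2011LMS] Def. 1.1; RESIDUAL-CASES.md §a.1 C6/C7, §a.2 X1; bsdN/HYPOTHESES.md T-CGS, T-GV0.
-/

noncomputable section

open scoped Classical

open WeierstrassCurve Literature.NumberTheory.EllipticCurves
  Literature.NumberTheory.EllipticCurves.ModularForms Literature.NumberTheory.EllipticCurves.Rank1Residual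

namespace Literature.NumberTheory.EllipticCurves.Rank1Residual

/-- **C7 in the canonical shape of the cell (rank `0`, Greenberg–Vatsal parity).** For `W/ℚ`
globally minimal elliptic and `p ≠ 2` good ordinary with `GVPar W p` and `ord_{s=1} L(E,s) = 0`:
`BSDp W p`, from Greenberg–Vatsal 2000 Thm. 1.3 (`hGV`), Greenberg 1999 Thm. 4.1 (`hGr`),
modularity (`hmod`, `hmodP`) and Gross–Zagier–Kolyvagin (`hGZK`) — the tree's
`GreenbergVatsal2000.pPartRankZero_of_gvPar` followed by the bridge `bsdp_of_pPartRankZero`.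
[cite: GreenbergVatsal2000, Thm. (1.3)] [cite: GreenbergLNM1716, Thm. 4.1 (p. 102)]
[cite: CastellaEtAl2021, Thm. 5.1.4 and its proof] [cite: Miller2011LMS, Def. 1.1] -/
theorem bsdp_of_gvPar_of_analyticRank_eq_zero
    (hGV : GreenbergVatsal2000.thm13_charIdeal_eq_of_gvPar) (hGr : greenberg_charValue_rankZero)
    (hmod : hasEntireLFunction_rat) (hmodP : nonempty_modularParametrizationData)
    (hGZK : rank_eq_analyticRank_of_analyticRank_le_one)
    (W : WeierstrassCurve ℚ) [W.IsElliptic] [W.IsGloballyMinimal] (p : ℕ) [Fact p.Prime]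
    (hp2 : p ≠ 2) (hord : GoodOrd W p) (hpar : GVPar W p) (hr0 : W.analyticRank = 0) :
    BSDp W p := by
  have hL : W.entireLFunction 1 ≠ 0 := (W.analyticRank_eq_zero_iff_holds (hmod W)).mp hr0
  have hGr' := fun (κ : ZpExtension ℚ p) (γ : Field.absoluteGaloisGroup ℚ) (hκ : κ.IsCyclotomic)
      (hγ : κ.IsTopGenerator γ) (hγ' : IsCyclotomicVariable p γ) (D : W.SelmerDualData κ γ)
      (_ : Module.Finite (IwasawaAlgebra p) D.X) (hX : D.IsTorsion) (fE : IwasawaAlgebra p)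
      (hfE : D.charIdeal = Ideal.span {fE}) (hSel : Finite (W.selmerGroupPInfty p)) ↦
    hGr W p hp2 hord.1 hord.2 κ γ hκ hγ hγ' D hX fE hfE hSel
  exact bsdp_of_pPartRankZero W p hmod hGZK hr0
    (GreenbergVatsal2000.pPartRankZero_of_gvPar hGV hmodP hGZK W p hp2 hord.1 hord.2 hpar hL hGr')

/-- **Outside X1, every good Eisenstein pair `p > 2` of analytic rank `≤ 1` satisfies `BSD(E,p)` from
PUBLISHED theorems.** For `W/ℚ` globally minimal elliptic, `2 < p`, `Good W p`, `Red W p`,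
`W.analyticRank ≤ 1` and `¬ ClassX1 W p`: `BSDp W p`, given the named facts
Castella–Grossi–Skinner 2025 Thm. D (`hD`, the `¬anom(p)` case, both ranks) and Greenberg–Vatsal 2000
Thm. 1.3 + Greenberg 1999 Thm. 4.1 (`hGV`, `hGr`, the `r_an = 0 ∧ gvpar(p)` case), modularity and
Gross–Zagier–Kolyvagin, and the per-pair torsion bit `p ∤ #E(ℚ)_tors` consulted only when `¬anom(p)`
(`htors`; automatic in print there). Equivalently: at a good Eisenstein `p > 2` the rank-`≤ 1`
residue of the published record is contained in X1 (= `anom(p) ∧ ¬(r_an = 0 ∧ gvpar(p))`), as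
RESIDUAL-CASES §a.2 asserts. [cite: CastellaGrossiSkinner2025, Theorem D]
[cite: GreenbergVatsal2000, Thm. (1.3)] [cite: GreenbergLNM1716, Thm. 4.1] [cite: Miller2011LMS, Def. 1.1] -/
theorem bsdp_of_good_red_of_not_classX1
    (hD : CastellaGrossiSkinner2025.thmD_padicValRat_bsd_rank_le_one)
    (hGV : GreenbergVatsal2000.thm13_charIdeal_eq_of_gvPar) (hGr : greenberg_charValue_rankZero)
    (hmod : hasEntireLFunction_rat) (hmodP : nonempty_modularParametrizationData)
    (hGZK : rank_eq_analyticRank_of_analyticRank_le_one)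
    (W : WeierstrassCurve ℚ) [W.IsElliptic] [W.IsGloballyMinimal] (p : ℕ) [Fact p.Prime]
    (hp : 2 < p) (hgood : Good W p) (hred : Red W p) (hr : W.analyticRank ≤ 1)
    (hX : ¬ ClassX1 W p) (htors : ¬ Anom W p → ¬ p ∣ W.torsionOrder) : BSDp W p := by
  by_cases hna : Anom W p
  · -- anomalous: not in X1 forces `r_an = 0 ∧ gvpar(p)` — the Greenberg–Vatsal chain (C7)
    have hrg : W.analyticRank = 0 ∧ GVPar W p := by
      by_contra h
      exact hX ⟨hp, hred, hgood, hna, h⟩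
    exact bsdp_of_gvPar_of_analyticRank_eq_zero hGV hGr hmod hmodP hGZK W p (by omega)
      (goodOrd_of_anom W p hna) hrg.2 hrg.1
  · -- non-anomalous: Castella–Grossi–Skinner 2025 Theorem D (C6)
    exact CastellaGrossiSkinner2025.bsdp_of_thmD hD hmod hGZK W p hp hgood hred hna hr (htors hna)

/-- **The same, class-free phrasing of the covered union C6 ∪ C7:** `2 < p`, `good(p)`, `red(p)`,
`r_an ≤ 1`, and (`¬anom(p)` ∨ (`r_an = 0 ∧ gvpar(p)`)) ⇒ `BSD(E,p)` (published inputs as above; the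
torsion bit only for `¬anom(p)`). [cite: CastellaGrossiSkinner2025, Theorem D] [cite: GreenbergVatsal2000, Thm. (1.3)] -/
theorem bsdp_of_not_anom_or_gvPar_rankZero
    (hD : CastellaGrossiSkinner2025.thmD_padicValRat_bsd_rank_le_one)
    (hGV : GreenbergVatsal2000.thm13_charIdeal_eq_of_gvPar) (hGr : greenberg_charValue_rankZero)
    (hmod : hasEntireLFunction_rat) (hmodP : nonempty_modularParametrizationData)
    (hGZK : rank_eq_analyticRank_of_analyticRank_le_one)
    (W : WeierstrassCurve ℚ) [W.IsElliptic] [W.IsGloballyMinimal] (p : ℕ) [Fact p.Prime]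
    (hp : 2 < p) (hgood : Good W p) (hred : Red W p) (hr : W.analyticRank ≤ 1)
    (hcov : ¬ Anom W p ∨ (W.analyticRank = 0 ∧ GVPar W p))
    (htors : ¬ Anom W p → ¬ p ∣ W.torsionOrder) : BSDp W p :=
  bsdp_of_good_red_of_not_classX1 hD hGV hGr hmod hmodP hGZK W p hp hgood hred hr
    (fun hX1 => hcov.elim (fun h => h hX1.2.2.2.1) (fun h => hX1.2.2.2.2 h)) htors

/-- **Bookkeeping converse: inside "good Eisenstein `p > 2`, `r_an ≤ 1`", the pairs NOT covered by
C6 ∪ C7 are exactly class X1.** Pure logic on the predicates (`Iff`), recorded so that the census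
sentence "X1 = the good-Eisenstein residue" is a kernel statement. [folklore] -/
theorem classX1_iff_not_covered {W : WeierstrassCurve ℚ} {p : ℕ} [Fact p.Prime]
    [W.IsGloballyMinimal] (hp : 2 < p) (hgood : Good W p) (hred : Red W p) :
    ClassX1 W p ↔ ¬ (¬ Anom W p ∨ (W.analyticRank = 0 ∧ GVPar W p)) := by
  constructor
  · rintro ⟨-, -, -, ha, hng⟩ (h | h)
    · exact h ha
    · exact hng h
  · intro h
    refine ⟨hp, hred, hgood, ?_, fun hrg => h (Or.inr hrg)⟩
    by_contra ha
    exact h (Or.inl ha)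

/-! ### (x1a gen 6) The torsion bit is a theorem: binder-free forms of C6, C6 ∪ C7 and the X1 boundary

`AnomalousOfRationalTorsionProofs.lean` (x1a gen 6) proves the sentence that the module docstring
and item 8 of the CGS file's docstring had to leave as the per-pair binder `htors`: at a good prime
`p ≥ 3`, a rational point of order `p` forces `a_p ≡ 1 (mod p)` (`N_p · T = O` for every torsion
`T ∈ E(ℚ)` by AEC VII.2.1 + VII.3.4/IV.6.1, so `p ∣ N_p = p + 1 - a_p`). Hence `¬anom(p) ⇒
p ∤ #E(ℚ)_tors`, and every theorem above holds WITHOUT the torsion bit: the good-Eisenstein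
boundary of class X1 is a class-level statement of the kernel with no per-pair input at all. -/

/-- **Rational `p`-torsion makes `p` an anomalous Eisenstein prime.** For `W/ℚ` globally minimal
elliptic, `2 < p` of good reduction and `p ∣ #E(ℚ)_tors`: `Anom W p` (`E[p]` reducible — the line of
the torsion point —, good, and `a_p ≡ 1 (mod p)` since `E(ℚ)_tors ↪ Ẽ(𝔽_p)`; Silverman AEC VII.3.1,
VII.3.4; Mazur 1972 §1). [cite: SilvermanAEC2009, VII.3.1(b) and VII.3.4] -/
theorem anom_of_dvd_torsionOrder (W : WeierstrassCurve ℚ) [W.IsElliptic] [W.IsGloballyMinimal]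
    (p : ℕ) [Fact p.Prime] (hp : 2 < p) (hgood : Good W p) (h : p ∣ W.torsionOrder) : Anom W p :=
  ⟨not_hasIrreducibleModPGaloisRep_of_dvd_torsionOrder W p h, hgood,
    dvd_frobeniusTrace_sub_one_of_dvd_torsionOrder W p hp hgood h⟩

/-- **At a non-anomalous good prime `p > 2`, `p ∤ #E(ℚ)_tors`** — the torsion bit `htors` of
`CastellaGrossiSkinner2025.bsdp_of_thmD` / `bsdp_of_good_red_of_not_classX1` is automatic, as in print.
[cite: SilvermanAEC2009, VII.3.1(b) and VII.3.4] -/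
theorem not_dvd_torsionOrder_of_not_anom (W : WeierstrassCurve ℚ) [W.IsElliptic]
    [W.IsGloballyMinimal] (p : ℕ) [Fact p.Prime] (hp : 2 < p) (hgood : Good W p)
    (hna : ¬ Anom W p) : ¬ p ∣ W.torsionOrder :=
  fun h ↦ hna (anom_of_dvd_torsionOrder W p hp hgood h)

/-- **C6 without the torsion bit: Castella–Grossi–Skinner 2025 Theorem D ⇒ `BSD(E,p)`** for every
`E/ℚ` (globally minimal `W`) with `ord_{s=1} L(E,s) ≤ 1` and every good Eisenstein prime `p > 2` with
`a_p ≢ 1 (mod p)` — exactly the printed scope, no per-pair input (`p ∤ #E(ℚ)_tors` is now the theorem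
`not_dvd_torsionOrder_of_not_anom`). Inputs by name: the fact `thmD_padicValRat_bsd_rank_le_one`,
modularity, Gross–Zagier–Kolyvagin. [cite: CastellaGrossiSkinner2025, Theorem D]
[cite: Miller2011LMS, Def. 1.1] -/
theorem bsdp_of_thmD_of_not_anom
    (hD : CastellaGrossiSkinner2025.thmD_padicValRat_bsd_rank_le_one)
    (hmod : hasEntireLFunction_rat) (hGZK : rank_eq_analyticRank_of_analyticRank_le_one)
    (W : WeierstrassCurve ℚ) [W.IsElliptic] [W.IsGloballyMinimal] (p : ℕ) [Fact p.Prime]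
    (hp : 2 < p) (hgood : Good W p) (hred : Red W p) (hna : ¬ Anom W p)
    (hr : W.analyticRank ≤ 1) : BSDp W p :=
  CastellaGrossiSkinner2025.bsdp_of_thmD hD hmod hGZK W p hp hgood hred hna hr
    (not_dvd_torsionOrder_of_not_anom W p hp hgood hna)

/-- **Outside X1, every good Eisenstein pair `p > 2` of analytic rank `≤ 1` satisfies `BSD(E,p)` from
PUBLISHED theorems — with NO per-pair input.** `bsdp_of_good_red_of_not_classX1` with its torsion
binder discharged by `not_dvd_torsionOrder_of_not_anom`: for `W/ℚ` globally minimal elliptic,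
`2 < p`, `good(p)`, `red(p)`, `r_an ≤ 1`, `¬ ClassX1 W p` ⇒ `BSDp W p`, from Castella–Grossi–Skinner
2025 Thm. D, Greenberg–Vatsal 2000 Thm. 1.3 + Greenberg 1999 Thm. 4.1, modularity and
Gross–Zagier–Kolyvagin. So "the rank-`≤ 1` residue at good Eisenstein `p > 2` is contained in X1" is
a class-level kernel statement. [cite: CastellaGrossiSkinner2025, Theorem D]
[cite: GreenbergVatsal2000, Thm. (1.3)] [cite: GreenbergLNM1716, Thm. 4.1] [cite: Miller2011LMS, Def. 1.1] -/
theorem bsdp_of_not_classX1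
    (hD : CastellaGrossiSkinner2025.thmD_padicValRat_bsd_rank_le_one)
    (hGV : GreenbergVatsal2000.thm13_charIdeal_eq_of_gvPar) (hGr : greenberg_charValue_rankZero)
    (hmod : hasEntireLFunction_rat) (hmodP : nonempty_modularParametrizationData)
    (hGZK : rank_eq_analyticRank_of_analyticRank_le_one)
    (W : WeierstrassCurve ℚ) [W.IsElliptic] [W.IsGloballyMinimal] (p : ℕ) [Fact p.Prime]
    (hp : 2 < p) (hgood : Good W p) (hred : Red W p) (hr : W.analyticRank ≤ 1)
    (hX : ¬ ClassX1 W p) : BSDp W p :=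
  bsdp_of_good_red_of_not_classX1 hD hGV hGr hmod hmodP hGZK W p hp hgood hred hr hX
    (fun hna ↦ not_dvd_torsionOrder_of_not_anom W p hp hgood hna)

/-- **C6 ∪ C7, class-free and binder-free:** `2 < p`, `good(p)`, `red(p)`, `r_an ≤ 1`, and
(`¬anom(p)` ∨ (`r_an = 0 ∧ gvpar(p)`)) ⇒ `BSD(E,p)`, from the published named facts only.
[cite: CastellaGrossiSkinner2025, Theorem D] [cite: GreenbergVatsal2000, Thm. (1.3)] -/
theorem bsdp_of_not_anom_or_gvPar_rankZero'
    (hD : CastellaGrossiSkinner2025.thmD_padicValRat_bsd_rank_le_one)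
    (hGV : GreenbergVatsal2000.thm13_charIdeal_eq_of_gvPar) (hGr : greenberg_charValue_rankZero)
    (hmod : hasEntireLFunction_rat) (hmodP : nonempty_modularParametrizationData)
    (hGZK : rank_eq_analyticRank_of_analyticRank_le_one)
    (W : WeierstrassCurve ℚ) [W.IsElliptic] [W.IsGloballyMinimal] (p : ℕ) [Fact p.Prime]
    (hp : 2 < p) (hgood : Good W p) (hred : Red W p) (hr : W.analyticRank ≤ 1)
    (hcov : ¬ Anom W p ∨ (W.analyticRank = 0 ∧ GVPar W p)) : BSDp W p :=
  bsdp_of_not_anom_or_gvPar_rankZero hD hGV hGr hmod hmodP hGZK W p hp hgood hred hr hcov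
    (fun hna ↦ not_dvd_torsionOrder_of_not_anom W p hp hgood hna)

/-- **The good-Eisenstein dichotomy of the published record (rank `≤ 1`, `p > 2`):** for `W/ℚ`
globally minimal elliptic, `2 < p` good with `E[p]` reducible and `ord_{s=1} L(E,s) ≤ 1`, EITHER
`BSD(E,p)` holds by the published theorems (CGS 2025 Thm. D ∪ Greenberg–Vatsal 2000 + Greenberg 1999,
modularity, GZK) OR the pair is in residual class X1 — no third case and no per-pair datum.
[cite: CastellaGrossiSkinner2025, Theorem D] [cite: GreenbergVatsal2000, Thm. (1.3)] -/
theorem bsdp_or_classX1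
    (hD : CastellaGrossiSkinner2025.thmD_padicValRat_bsd_rank_le_one)
    (hGV : GreenbergVatsal2000.thm13_charIdeal_eq_of_gvPar) (hGr : greenberg_charValue_rankZero)
    (hmod : hasEntireLFunction_rat) (hmodP : nonempty_modularParametrizationData)
    (hGZK : rank_eq_analyticRank_of_analyticRank_le_one)
    (W : WeierstrassCurve ℚ) [W.IsElliptic] [W.IsGloballyMinimal] (p : ℕ) [Fact p.Prime]
    (hp : 2 < p) (hgood : Good W p) (hred : Red W p) (hr : W.analyticRank ≤ 1) :
    BSDp W p ∨ ClassX1 W p := by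
  by_cases hX : ClassX1 W p
  · exact Or.inr hX
  · exact Or.inl (bsdp_of_not_classX1 hD hGV hGr hmod hmodP hGZK W p hp hgood hred hr hX)

end Literature.NumberTheory.EllipticCurves.Rank1Residual
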